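import Summits.Parity.BatemanHorn.Theorems.SoloInformedRootPairCorrelation
import Literature.NumberTheory.Sieve.PolynomialCongruencesLemmas

/-!
# Pair correlation of root fractions, II: the CRT structure of the cross terms

Informed soloist `solo-Parity-informed` (session 144), conjunct `BatemanHorn`, the `d ≥ 3` rung BELOW the parity wall;
companion of `SoloInformedRootPairCorrelation` (the Fejér pair sum `rootPairSum g E E' H = ∑_{p,p'} F_H(x_p − x_{p'})` of the
root fractions `x_p = ν/e`, `E < e ≤ E'`, `g(ν) ≡ 0 (mod e)`, and its equivalence with the second moment of
`T(h) = ∑_{E<e≤E'} S_g(h;e)`).  By `rootPairSum_eq_sum_moduli` the pair sum is a sum of BLOCKS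
`B_H(e,e') = ∑_{ν (mod e), ν' (mod e')} F_H(ν/e − ν'/e')` over ordered pairs of moduli.  This file identifies the blocks of
COPRIME moduli `(e, e') = 1` exactly, by the Chinese remainder theorem in the tree's form
(`Literature.NumberTheory.Sieve.polyRootWeylSum_mul_of_coprime`, `…_eq_of_modEq` of `PolynomialCongruencesLemmas`):

* `hooleySum_eq_polyRootWeylSum`: the soloist's `hooleySum g q h` IS the Literature's `polyRootWeylSum g q h` (bridge, so
  that every Literature fact about `ρ_h(d)` is available for `S_g(h;q)`); `hooleySum_neg`: `S_g(−h;q) = conj S_g(h;q)`;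
* **CRT gluing of a cross term** (`hooleySum_mul_hooleySum_neg_of_coprime`): for `(e,e') = 1` and every `h`,
  `S_g(h;e) · S_g(−h;e') = S_g(h·(e' − e); e·e')` — the product of the Hooley sums of two coprime moduli at opposite
  frequencies is ONE Hooley sum to the product modulus, at the frequency `h(e' − e)` dilated by the DIFFERENCE of the moduli;
* **the coprime block is a located-roots count** (`sum_rootResidues_fejer_eq_of_coprime`): for `(e,e') = 1` and every `H`,
  `B_H(e,e') = ∑_{λ (mod ee'), g(λ)≡0} F_H(λ·(e' − e)/(ee'))` — the Fejér-smoothed pair correlation at scale `1/H` between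
  the roots modulo `e` and the roots modulo `e'` EQUALS the Fejér-smoothed number of roots `λ` of `g` to the modulus
  `q = ee' ≍ E²` whose dilate `(e' − e)λ` lies within `≍ q/H` of `0` modulo `q`.

READING (prose only).  With `k = e' − e` (`|k| < E`) and `q = ee'`, the right-hand side counts roots of `g` modulo `q` in the
union of the `|k|` arcs `{λ : ‖kλ/q‖ ≲ 1/H}`, each of length `≍ q/(|k|H)`; equidistribution of the `ρ_g(q)` roots modulo the
FACTORABLE modulus `q = ee'` at that scale (for `H ≤ 2E^θ` the arcs have length `≳ E^{1−θ} → ∞` when `θ < 1`, but are SHORT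
compared with `q ≍ E²`) is what the pair-correlation hypothesis `HooleyPairCorrelationLocal g θ η` asks for on the coprime
blocks, and summing over the `≍ E²` coprime pairs `(e, e')` with the difference `k` as a parameter exhibits the hypothesis as
a statement about roots of `g` to moduli `q ≤ 4E²` that factor as `e(e+k)`, located in arcs of length `q/(|k|H)` — Hooley's
1964 equidistribution problem for INCOMPLETE arcs and SPECIAL (factorable) moduli, averaged over `k` and `e`.  For
`deg g = 2` this is the regime of the Bykovskii–Duke–Friedlander–Iwaniec–Tóth spectral methods; for `deg g = 3` Welsh's
parametrisation of PAIRS of cubic roots by ideals of the cubic order (arXiv:2008.00538, Thms 3, 6, 7; Prop. 11–12: composition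
of the parametrising forms ↔ exactly this CRT gluing) is the only structural input in print.  The non-coprime blocks
(`(e,e') = δ > 1`, a proportion `1 − 6/π²` of the pairs, including the diagonal `e = e'`) glue through the common part `δ` and
are not typed here.  Nothing parity-blocked is touched.
-/

namespace Summit.Parity.BatemanHorn.Theorems

open Finset Polynomial
open Literature.NumberTheory.Sieve (polyRootCountMod polyRootWeylSum polyRootWeylSum_eq_of_modEq
  polyRootWeylSum_mul_of_coprime)
open Literature.Barriers.AtomisticToContinuum.HeatConduction (fejer)

/-! ### The bridge to the Literature's `polyRootWeylSum` and complex conjugation -/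

/-- **Bridge.**  `hooleySum g q h = polyRootWeylSum g q h` (`Literature.NumberTheory.Sieve.PolynomialCongruences`):
the same sum `∑_{0≤ν<q, q ∣ g(ν)} e(hν/q)`. [this work] -/
theorem hooleySum_eq_polyRootWeylSum (g : ℤ[X]) (q : ℕ) (h : ℤ) :
    hooleySum g q h = polyRootWeylSum g q h := by
  unfold hooleySum rootResidues polyRootWeylSum eAdd
  refine sum_congr rfl fun ν _ => ?_
  congr 1
  push_cast
  ring

/-- `conj e_q(k) = e_q(−k)`. [folklore] -/
theorem starRingEnd_eAdd (q : ℕ) (k : ℤ) : starRingEnd ℂ (eAdd q k) = eAdd q (-k) := by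
  unfold eAdd
  rw [← Complex.exp_conj]
  congr 1
  simp only [map_mul, map_div₀, Complex.conj_ofReal, Complex.conj_I, map_ofNat, map_intCast, map_natCast]
  push_cast
  ring

/-- `S_g(−h;q) = conj S_g(h;q)`. [folklore] -/
theorem hooleySum_neg (g : ℤ[X]) (q : ℕ) (h : ℤ) :
    hooleySum g q (-h) = starRingEnd ℂ (hooleySum g q h) := by
  unfold hooleySum
  rw [map_sum]
  exact sum_congr rfl fun ν _ => by rw [starRingEnd_eAdd, neg_mul]

/-- `Re(e^{ia} · e^{ib}) = cos(a + b)`. [folklore] -/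
private theorem re_exp_mul_I_mul_exp_mul_I (a b : ℝ) :
    (Complex.exp ((a : ℂ) * Complex.I) * Complex.exp ((b : ℂ) * Complex.I)).re = Real.cos (a + b) := by
  rw [← Complex.exp_add, ← add_mul, ← Complex.ofReal_add, Complex.exp_ofReal_mul_I_re]

/-! ### CRT gluing of a cross term -/

/-- **CRT gluing of a cross term.**  For coprime moduli `e, e'` and every frequency `h`:
`S_g(h;e) · S_g(−h;e') = S_g(h·(e' − e); e·e')`.  (From `polyRootWeylSum_mul_of_coprime` with the Bézout inverses:
`h(e' − e)·ē' ≡ h (mod e)` and `h(e' − e)·ē ≡ −h (mod e')`.) [this work] -/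
theorem hooleySum_mul_hooleySum_neg_of_coprime (g : ℤ[X]) {e e' : ℕ} (hc : e.Coprime e') (h : ℤ) :
    hooleySum g e h * hooleySum g e' (-h) = hooleySum g (e * e') (h * ((e' : ℤ) - e)) := by
  simp only [hooleySum_eq_polyRootWeylSum]
  obtain ⟨u, v, huv⟩ : IsCoprime (e : ℤ) (e' : ℤ) := Nat.isCoprime_iff_coprime.mpr hc
  have he₁ : (e : ℤ) * u ≡ 1 [ZMOD e'] :=
    Int.modEq_iff_dvd.mpr ⟨v, by linear_combination (-1 : ℤ) * huv⟩
  have he₂ : (e' : ℤ) * v ≡ 1 [ZMOD e] :=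
    Int.modEq_iff_dvd.mpr ⟨u, by linear_combination (-1 : ℤ) * huv⟩
  rw [polyRootWeylSum_mul_of_coprime g hc he₁ he₂ (h * ((e' : ℤ) - e))]
  congr 1
  · refine polyRootWeylSum_eq_of_modEq g (Int.modEq_iff_dvd.mpr ⟨-(h * (u + v)), ?_⟩)
    linear_combination h * huv
  · refine polyRootWeylSum_eq_of_modEq g (Int.modEq_iff_dvd.mpr ⟨h * (u + v), ?_⟩)
    linear_combination (-h) * huv

/-- The same with the roles of the two moduli displayed symmetrically:
`S_g(−h;e) · S_g(h;e') = S_g(h·(e − e'); e·e')`. [this work] -/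
theorem hooleySum_neg_mul_hooleySum_of_coprime (g : ℤ[X]) {e e' : ℕ} (hc : e.Coprime e') (h : ℤ) :
    hooleySum g e (-h) * hooleySum g e' h = hooleySum g (e * e') (h * ((e : ℤ) - e')) := by
  rw [mul_comm, hooleySum_mul_hooleySum_neg_of_coprime g hc.symm h, mul_comm e' e]

/-! ### The coprime block of the pair sum is a located-roots count to the product modulus -/

/-- `Re(S_g(m;e) · S_g(−m;e')) = ∑_{ν,ν'} cos(2πm(ν/e − ν'/e'))`. [this work] -/
theorem re_hooleySum_mul_hooleySum_neg (g : ℤ[X]) (e e' : ℕ) (m : ℤ) :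
    (hooleySum g e m * hooleySum g e' (-m)).re =
      ∑ ν ∈ rootResidues g e, ∑ ν' ∈ rootResidues g e',
        Real.cos (2 * Real.pi * m * ((ν : ℝ) / e - (ν' : ℝ) / e')) := by
  unfold hooleySum
  rw [sum_mul_sum, Complex.re_sum]
  refine sum_congr rfl fun ν _ => ?_
  rw [Complex.re_sum]
  refine sum_congr rfl fun ν' _ => ?_
  rw [eAdd_eq_exp_ofReal_mul_I, eAdd_eq_exp_ofReal_mul_I, re_exp_mul_I_mul_exp_mul_I]
  congr 1
  push_cast
  ring

/-- `Re S_g(m;q) = ∑_{λ} cos(2πmλ/q)`. [this work] -/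
theorem re_hooleySum (g : ℤ[X]) (q : ℕ) (m : ℤ) :
    (hooleySum g q m).re = ∑ l ∈ rootResidues g q, Real.cos (2 * Real.pi * m * ((l : ℝ) / q)) := by
  unfold hooleySum
  rw [Complex.re_sum]
  refine sum_congr rfl fun l _ => ?_
  rw [eAdd_eq_exp_ofReal_mul_I, Complex.exp_ofReal_mul_I_re]
  congr 1
  push_cast
  ring

/-- **The coprime block is a located-roots count.**  For coprime moduli `e, e'` and every `H`:
`∑_{ν (mod e), ν' (mod e')} F_H(ν/e − ν'/e') = ∑_{λ (mod ee'), g(λ) ≡ 0} F_H(λ·(e' − e)/(ee'))` — the pair correlation at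
scale `1/H` between the roots modulo `e` and the roots modulo `e'` is the Fejér-smoothed number of roots `λ` of `g` modulo
`q = ee'` with `‖(e' − e)λ/q‖ ≲ 1/H`. [this work] -/
theorem sum_rootResidues_fejer_eq_of_coprime (g : ℤ[X]) {e e' : ℕ} (hc : e.Coprime e') (H : ℕ) :
    ∑ ν ∈ rootResidues g e, ∑ ν' ∈ rootResidues g e', fejer H ((ν : ℝ) / e - (ν' : ℝ) / e') =
      ∑ l ∈ rootResidues g (e * e'), fejer H ((l : ℝ) * ((e' : ℝ) - e) / ((e : ℝ) * e')) := by
  rcases Nat.eq_zero_or_pos H with rfl | hH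
  · simp [fejer]
  have hH0 : (H : ℝ) ≠ 0 := by positivity
  have h1 : ∀ s : ℝ, (H : ℝ) * fejer H s =
      ∑ kk ∈ range H ×ˢ range H, Real.cos (2 * Real.pi * ((kk.1 : ℝ) - kk.2) * s) := fun s => by
    rw [natCast_mul_fejer, sum_product]
  have hA : ∀ m : ℤ, (hooleySum g e m * hooleySum g e' (-m)).re =
      ∑ pp ∈ rootResidues g e ×ˢ rootResidues g e',
        Real.cos (2 * Real.pi * m * ((pp.1 : ℝ) / e - (pp.2 : ℝ) / e')) := fun m => by
    rw [re_hooleySum_mul_hooleySum_neg, sum_product]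
  have hX : ∀ m : ℤ, hooleySum g e m * hooleySum g e' (-m) = hooleySum g (e * e') (m * ((e' : ℤ) - e)) :=
    hooleySum_mul_hooleySum_neg_of_coprime g hc
  apply mul_left_cancel₀ hH0
  calc (H : ℝ) * ∑ ν ∈ rootResidues g e, ∑ ν' ∈ rootResidues g e', fejer H ((ν : ℝ) / e - (ν' : ℝ) / e')
      = ∑ pp ∈ rootResidues g e ×ˢ rootResidues g e', (H : ℝ) * fejer H ((pp.1 : ℝ) / e - (pp.2 : ℝ) / e') := by
        rw [← sum_product', mul_sum]
    _ = ∑ pp ∈ rootResidues g e ×ˢ rootResidues g e', ∑ kk ∈ range H ×ˢ range H,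
          Real.cos (2 * Real.pi * ((kk.1 : ℝ) - kk.2) * ((pp.1 : ℝ) / e - (pp.2 : ℝ) / e')) :=
        sum_congr rfl fun pp _ => h1 _
    _ = ∑ kk ∈ range H ×ˢ range H, ∑ pp ∈ rootResidues g e ×ˢ rootResidues g e',
          Real.cos (2 * Real.pi * ((kk.1 : ℝ) - kk.2) * ((pp.1 : ℝ) / e - (pp.2 : ℝ) / e')) := sum_comm
    _ = ∑ kk ∈ range H ×ˢ range H,
          (hooleySum g e ((kk.1 : ℤ) - kk.2) * hooleySum g e' (-((kk.1 : ℤ) - kk.2))).re :=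
        sum_congr rfl fun kk _ => by rw [hA]; push_cast; rfl
    _ = ∑ kk ∈ range H ×ˢ range H,
          (hooleySum g (e * e') (((kk.1 : ℤ) - kk.2) * ((e' : ℤ) - e))).re := by
        simp_rw [hX]
    _ = ∑ kk ∈ range H ×ˢ range H, ∑ l ∈ rootResidues g (e * e'),
          Real.cos (2 * Real.pi * ((kk.1 : ℝ) - kk.2) * ((l : ℝ) * ((e' : ℝ) - e) / ((e : ℝ) * e'))) :=
        sum_congr rfl fun kk _ => by
          rw [re_hooleySum]
          refine sum_congr rfl fun l _ => ?_
          congr 1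
          push_cast
          ring
    _ = ∑ l ∈ rootResidues g (e * e'), ∑ kk ∈ range H ×ˢ range H,
          Real.cos (2 * Real.pi * ((kk.1 : ℝ) - kk.2) * ((l : ℝ) * ((e' : ℝ) - e) / ((e : ℝ) * e'))) := sum_comm
    _ = ∑ l ∈ rootResidues g (e * e'), (H : ℝ) * fejer H ((l : ℝ) * ((e' : ℝ) - e) / ((e : ℝ) * e')) :=
        sum_congr rfl fun l _ => (h1 _).symm
    _ = (H : ℝ) * ∑ l ∈ rootResidues g (e * e'), fejer H ((l : ℝ) * ((e' : ℝ) - e) / ((e : ℝ) * e')) := by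
        rw [mul_sum]

end Summit.Parity.BatemanHorn.Theorems
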